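import Summits.Ventures.Crystal3D.StickySpheres.GraphStratum
import HarnessLib

/-!
# Relabelling a degree-four vertex, and counting edges as increasing pairs

Venture `Crystal3D` (cell `pub-crystal3d`, seat p2). Two small combinatorial tools used by `StickySpheres/ContactEight.lean`
(the kernel proof of `C(8) = 18`):
* `exists_relabel` — a vertex `w` of degree `4` in a graph on `Fin 8` can be moved to `7` with its four neighbours at
  `3, 4, 5, 6` by a bijection of `Fin 8` (so that the kernel search of `EightVertexSearch.lean` applies);
* `card_filter_lt_adj` — the edges of a graph on `Fin n` are in bijection with the adjacent increasing pairs `(a, b)`, `a < b`.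

HONEST FRAMING: elementary finite combinatorics; nothing geometric and nothing about crystallization is claimed here.
-/

noncomputable section

open Finset

namespace Summit.Ventures.Crystal3D

/-! ### 1. Relabelling a degree-four vertex to `7` with neighbours `3, 4, 5, 6` -/

/-- A vertex `w` of degree `4` in a graph on `Fin 8` can be relabelled to `7` with its neighbours at `3, 4, 5, 6`: there is
a bijection `g` (new label ↦ old vertex) with `g 7 = w` and, for `j ≠ 7`, `G.Adj w (g j) ↔ 3 ≤ j`. [folklore] -/
theorem exists_relabel (G : SimpleGraph (Fin 8)) [DecidableRel G.Adj] (w : Fin 8) (hw : G.degree w = 4) :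
    ∃ g : Fin 8 ≃ Fin 8, g 7 = w ∧ ∀ j : Fin 8, j ≠ 7 → (G.Adj w (g j) ↔ 3 ≤ j.val) := by
  classical
  set N : Finset (Fin 8) := G.neighborFinset w with hNdef
  set R : Finset (Fin 8) := univ \ insert w N with hRdef
  have hN : N.card = 4 := by rw [hNdef, SimpleGraph.card_neighborFinset_eq_degree, hw]
  have hwN : w ∉ N := by rw [hNdef, SimpleGraph.mem_neighborFinset]; exact G.irrefl
  have hR : R.card = 3 := by
    rw [hRdef, card_univ_sdiff, Fintype.card_fin, card_insert_of_notMem hwN, hN]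
  -- the relabelling, block by block
  let g : Fin 8 → Fin 8 := fun j =>
    if h3 : j.val < 3 then R.orderEmbOfFin hR ⟨j.val, h3⟩
    else if h7 : j.val < 7 then N.orderEmbOfFin hN ⟨j.val - 3, by omega⟩ else w
  have gR : ∀ j : Fin 8, ∀ h3 : j.val < 3, g j = R.orderEmbOfFin hR ⟨j.val, h3⟩ := fun j h3 => by
    simp only [g, dif_pos h3]
  have gN : ∀ j : Fin 8, ¬ j.val < 3 → ∀ h7 : j.val < 7, g j = N.orderEmbOfFin hN ⟨j.val - 3, by omega⟩ :=
    fun j h3 h7 => by simp only [g, dif_neg h3, dif_pos h7]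
  have g7 : ∀ j : Fin 8, ¬ j.val < 7 → g j = w := fun j h7 => by
    simp only [g, dif_neg (show ¬ j.val < 3 by omega), dif_neg h7]
  have memR : ∀ j : Fin 8, j.val < 3 → g j ∈ R := fun j h3 => by rw [gR j h3]; exact R.orderEmbOfFin_mem hR _
  have memN : ∀ j : Fin 8, ¬ j.val < 3 → j.val < 7 → g j ∈ N := fun j h3 h7 => by
    rw [gN j h3 h7]; exact N.orderEmbOfFin_mem hN _
  have hRN : ∀ v, v ∈ R → v ∉ N := fun v hv hvN => by
    rw [hRdef, mem_sdiff] at hv; exact hv.2 (mem_insert_of_mem hvN)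
  have hRw : ∀ v, v ∈ R → v ≠ w := fun v hv hvw => by
    rw [hRdef, mem_sdiff] at hv; exact hv.2 (hvw ▸ mem_insert_self _ _)
  have hinj : Function.Injective g := by
    intro i j hij
    by_cases hi3 : i.val < 3 <;> by_cases hj3 : j.val < 3
    · have e : (⟨i.val, hi3⟩ : Fin 3) = ⟨j.val, hj3⟩ := by
        apply (R.orderEmbOfFin hR).injective; rw [← gR i hi3, ← gR j hj3, hij]
      exact Fin.ext (by simpa using e)
    · exfalso
      by_cases hj7 : j.val < 7
      · exact hRN _ (memR i hi3) (hij ▸ memN j hj3 hj7)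
      · exact hRw _ (memR i hi3) (hij.trans (g7 j hj7))
    · exfalso
      by_cases hi7 : i.val < 7
      · exact hRN _ (memR j hj3) (hij.symm ▸ memN i hi3 hi7)
      · exact hRw _ (memR j hj3) (hij.symm.trans (g7 i hi7))
    · by_cases hi7 : i.val < 7 <;> by_cases hj7 : j.val < 7
      · have e : (⟨i.val - 3, by omega⟩ : Fin 4) = ⟨j.val - 3, by omega⟩ := by
          apply (N.orderEmbOfFin hN).injective; rw [← gN i hi3 hi7, ← gN j hj3 hj7, hij]
        have e' : i.val - 3 = j.val - 3 := by simpa using e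
        exact Fin.ext (by omega)
      · exfalso; exact hwN ((g7 j hj7) ▸ hij ▸ memN i hi3 hi7)
      · exfalso; exact hwN ((g7 i hi7) ▸ hij.symm ▸ memN j hj3 hj7)
      · exact Fin.ext (by omega)
  refine ⟨Equiv.ofBijective g (Finite.injective_iff_bijective.1 hinj), g7 7 (by decide), fun j hj => ?_⟩
  rw [Equiv.ofBijective_apply]
  by_cases h3 : j.val < 3
  · constructor
    · intro hadj
      exact absurd ((SimpleGraph.mem_neighborFinset G w _).2 hadj) (hRN _ (memR j h3))
    · intro h; omega
  · have h7 : j.val < 7 := by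
      have := j.isLt
      have hne : j.val ≠ 7 := fun h => hj (Fin.ext h)
      omega
    constructor
    · intro _; omega
    · intro _
      exact (SimpleGraph.mem_neighborFinset G w _).1 (memN j h3 h7)

/-! ### 2. Counting edges as increasing pairs -/

/-- The edges of a graph on `Fin n` are in bijection with the adjacent increasing pairs. [folklore] -/
theorem card_filter_lt_adj {n : ℕ} (H : SimpleGraph (Fin n)) [DecidableRel H.Adj] :
    (univ.filter fun p : Fin n × Fin n => p.1 < p.2 ∧ H.Adj p.1 p.2).card = H.edgeFinset.card := by
  refine Finset.card_bij (fun p _ => s(p.1, p.2)) (fun p hp => ?_) (fun p hp q hq hpq => ?_) (fun e he => ?_)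
  · rw [mem_filter] at hp
    rw [SimpleGraph.mem_edgeFinset, SimpleGraph.mem_edgeSet]
    exact hp.2.2
  · rw [mem_filter] at hp hq
    rcases Sym2.eq_iff.1 hpq with ⟨h1, h2⟩ | ⟨h1, h2⟩
    · exact Prod.ext h1 h2
    · exfalso
      have := hp.2.1; have := hq.2.1
      rw [h1] at *; rw [h2] at *
      exact lt_asymm ‹q.2 < q.1› ‹q.1 < q.2›
  · induction e using Sym2.ind with
    | h u v =>
      rw [SimpleGraph.mem_edgeFinset, SimpleGraph.mem_edgeSet] at he
      rcases lt_or_gt_of_ne (H.ne_of_adj he) with h | h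
      · exact ⟨(u, v), by rw [mem_filter]; exact ⟨mem_univ _, h, he⟩, rfl⟩
      · exact ⟨(v, u), by rw [mem_filter]; exact ⟨mem_univ _, h, he.symm⟩, Sym2.eq_swap⟩

end Summit.Ventures.Crystal3D

end
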